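import Summits.AtomisticToContinuum.Crystallization.Theorems.FrustratedLawDichotomyCoherentFloor
import Literature.Analysis.Convexity.OpenHPolytope
import Summits.AtomisticToContinuum.Crystallization.Theorems.FrustratedLawDichotomyFarFieldSharp

/-!
# FrustratedLawDichotomy · crux `AperiodicFrustratedLawGap` (stmt-AtomisticToContinuum-27623) — CELL-SOUND, generic half: WINDOW ENCLOSURES of the
# closed forms in `certFloor` (decomp-a2c, RESIDUAL lens-5, generation 112; critic r1759 (B) m2 «box soundness», memo CELLSOUND-g112 §1–§2)

A class-A cell certifies `2(e⋆ + m_cell) ≤ certFloor (a_F) I (y_F) τ Rc` for every strain `F` in a rational box by integer (fixed-point) interval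
arithmetic.  This file is the REAL-ANALYSIS half of that bridge, once and for all, representation-free (the K files cast their integers to these
real hypotheses): for a squared-distance window `t = r² ∈ [lo, hi]`, `0 < lo`, monotone-atom enclosures of every scalar closed form that `certFloor`
((226) `…CoherentFloor.certFloor`) is built from —

* §1 atoms: t⁻¹^k antitone = TREE `…FarFieldSharp.inv_pow_le_inv_pow_of_le` (cited, lane ed1), the four-corner product rule `mul_le_of_corners`/`corners_le_mul`, `abs_le_max_neg` (`|x| ≤ max (−lo) hi`);
* §2 the potential pieces of (225): `psiT_mem` (`ψ ∈ [hi⁻⁴ − lo⁻⁷, lo⁻⁴ − hi⁻⁷]`), `psiT1_mem`, `phiT1_mem`, `phiT2_mem`, `abs_psiT1_le`, `secondNeg_le`;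
* §3 the booked columns: `forceRem_le_window`, `energyRem_le_window` (UPPER enclosures on an `r`-window, `η` exact), `farCol_anti`, `tailCol_anti`
  (antitone on `(0, ∞)`), `farCol_le_of_norm_le` (the form (226) uses: `‖x‖ ≤ ρ ⇒ farCol (Rc − (ρ + τ))` majorises);
* §4 vectors in `E3`, sqrt-free: `norm_le_of_sq_sum_le` (`0 ≤ b ∧ Σ_i w_i² ≤ b² ⇒ ‖w‖ ≤ b`, via the Literature identity
  `Literature.Analysis.Convexity.norm_sq_eq_sum_sq_coord`), `sq_sum_le_of_coord_mem` (coordinate boxes ⇒ `Σ w_i² ≤ Σ max(−lo_i, hi_i)²`); the coordinate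
  form of the inner product for the signed multiplier pairings is the Literature lemma `Literature.Geometry.DiscreteGeometry.inner_eq_sum_coord` (cited, not restated).

The host term's LOWER enclosure is (229) `…ShellMinimum.shellMin_le_phiT` (exact).  Nothing here unfolds `certFloor`; the per-cell master lemma
(termwise `Finset.sum_le_sum` over the template index set) is the next file.  DEF-FREE; imports (226) + `Literature.Analysis.Convexity.OpenHPolytope` (for the norm identity); 0 sorry.  Tags: [folklore].
-/

noncomputable section

namespace Summit.AtomisticToContinuum.Crystallization.Theorems.FrustratedLawDichotomyCellEnclosures

open Summit.AtomisticToContinuum.Crystallization.Theorems.FrustratedLawDichotomyFarFieldSharp (inv_pow_le_inv_pow_of_le)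

open Summit.AtomisticToContinuum.Crystallization.Theorems.FrustratedLawDichotomyCoherentFloorAlgebra
  (phiT phiT1 phiT2 psiT psiT1 forceRem energyRem secondNeg)
open Summit.AtomisticToContinuum.Crystallization.Theorems.FrustratedLawDichotomyCoherentFloor (farCol tailCol)
open scoped BigOperators

/-! ## §1. Atoms -/

/-- `t⁻¹^k` is nonnegative for `0 ≤ t`. [folklore] -/
theorem inv_pow_nonneg' {t : ℝ} (h0 : 0 ≤ t) (k : ℕ) : 0 ≤ t⁻¹ ^ k := pow_nonneg (inv_nonneg.2 h0) k

/-- FOUR-CORNER RULE, upper half: on a box, a product is at most the largest corner product. [folklore] -/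
theorem mul_le_of_corners {a b a₁ a₂ b₁ b₂ : ℝ} (ha₁ : a₁ ≤ a) (ha₂ : a ≤ a₂) (hb₁ : b₁ ≤ b) (hb₂ : b ≤ b₂) :
    a * b ≤ max (max (a₁ * b₁) (a₁ * b₂)) (max (a₂ * b₁) (a₂ * b₂)) := by
  rcases le_total 0 b with hb | hb
  · -- `a * b ≤ a₂ * b`, then corner in `b`
    have h1 : a * b ≤ a₂ * b := mul_le_mul_of_nonneg_right ha₂ hb
    rcases le_total 0 a₂ with h2 | h2
    · exact (h1.trans (mul_le_mul_of_nonneg_left hb₂ h2)).trans ((le_max_right _ _).trans (le_max_right _ _))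
    · exact (h1.trans (mul_le_mul_of_nonpos_left hb₁ h2)).trans ((le_max_left _ _).trans (le_max_right _ _))
  · have h1 : a * b ≤ a₁ * b := mul_le_mul_of_nonpos_right ha₁ hb
    rcases le_total 0 a₁ with h2 | h2
    · exact (h1.trans (mul_le_mul_of_nonneg_left hb₂ h2)).trans ((le_max_right _ _).trans (le_max_left _ _))
    · exact (h1.trans (mul_le_mul_of_nonpos_left hb₁ h2)).trans ((le_max_left _ _).trans (le_max_left _ _))

/-- FOUR-CORNER RULE, lower half: on a box, a product is at least the smallest corner product. [folklore] -/
theorem corners_le_mul {a b a₁ a₂ b₁ b₂ : ℝ} (ha₁ : a₁ ≤ a) (ha₂ : a ≤ a₂) (hb₁ : b₁ ≤ b) (hb₂ : b ≤ b₂) :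
    min (min (a₁ * b₁) (a₁ * b₂)) (min (a₂ * b₁) (a₂ * b₂)) ≤ a * b := by
  rcases le_total 0 b with hb | hb
  · have h1 : a₁ * b ≤ a * b := mul_le_mul_of_nonneg_right ha₁ hb
    rcases le_total 0 a₁ with h2 | h2
    · exact ((min_le_left _ _).trans (min_le_left _ _)).trans ((mul_le_mul_of_nonneg_left hb₁ h2).trans h1)
    · exact ((min_le_left _ _).trans (min_le_right _ _)).trans ((mul_le_mul_of_nonpos_left hb₂ h2).trans h1)
  · have h1 : a₂ * b ≤ a * b := mul_le_mul_of_nonpos_right ha₂ hb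
    rcases le_total 0 a₂ with h2 | h2
    · exact ((min_le_right _ _).trans (min_le_left _ _)).trans ((mul_le_mul_of_nonneg_left hb₁ h2).trans h1)
    · exact ((min_le_right _ _).trans (min_le_right _ _)).trans ((mul_le_mul_of_nonpos_left hb₂ h2).trans h1)

/-- An enclosed quantity has absolute value at most `max (−lo) hi` (sharper than `max |lo| |hi|`, and abs-free on the endpoints). [folklore] -/
theorem abs_le_max_neg {x lo hi : ℝ} (h1 : lo ≤ x) (h2 : x ≤ hi) : |x| ≤ max (-lo) hi := by
  rcases le_total 0 x with hx | hx
  · exact (abs_of_nonneg hx).le.trans (h2.trans (le_max_right _ _))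
  · rw [abs_of_nonpos hx]
    exact (neg_le_neg h1).trans (le_max_left _ _)

/-! ## §2. The potential pieces on a `t`-window `[lo, hi]`, `0 < lo` -/

/-- `ψ(t) = t⁻⁴ − t⁻⁷ ∈ [hi⁻⁴ − lo⁻⁷, lo⁻⁴ − hi⁻⁷]`. [folklore] -/
theorem psiT_mem {lo hi t : ℝ} (h0 : 0 < lo) (h1 : lo ≤ t) (h2 : t ≤ hi) :
    hi⁻¹ ^ 4 - lo⁻¹ ^ 7 ≤ psiT t ∧ psiT t ≤ lo⁻¹ ^ 4 - hi⁻¹ ^ 7 := by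
  unfold psiT
  have := inv_pow_le_inv_pow_of_le h0 h1 4; have := inv_pow_le_inv_pow_of_le h0 h1 7
  have := inv_pow_le_inv_pow_of_le (h0.trans_le h1) h2 4; have := inv_pow_le_inv_pow_of_le (h0.trans_le h1) h2 7
  constructor <;> linarith

/-- `ψ′(t) = −4t⁻⁵ + 7t⁻⁸ ∈ [−4lo⁻⁵ + 7hi⁻⁸, −4hi⁻⁵ + 7lo⁻⁸]`. [folklore] -/
theorem psiT1_mem {lo hi t : ℝ} (h0 : 0 < lo) (h1 : lo ≤ t) (h2 : t ≤ hi) :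
    -4 * lo⁻¹ ^ 5 + 7 * hi⁻¹ ^ 8 ≤ psiT1 t ∧ psiT1 t ≤ -4 * hi⁻¹ ^ 5 + 7 * lo⁻¹ ^ 8 := by
  unfold psiT1
  have := inv_pow_le_inv_pow_of_le h0 h1 5; have := inv_pow_le_inv_pow_of_le h0 h1 8
  have := inv_pow_le_inv_pow_of_le (h0.trans_le h1) h2 5; have := inv_pow_le_inv_pow_of_le (h0.trans_le h1) h2 8
  constructor <;> linarith

/-- `|ψ′(t)|` on a window. [folklore] -/
theorem abs_psiT1_le {lo hi t : ℝ} (h0 : 0 < lo) (h1 : lo ≤ t) (h2 : t ≤ hi) :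
    |psiT1 t| ≤ max (-(-4 * lo⁻¹ ^ 5 + 7 * hi⁻¹ ^ 8)) (-4 * hi⁻¹ ^ 5 + 7 * lo⁻¹ ^ 8) :=
  abs_le_max_neg (psiT1_mem h0 h1 h2).1 (psiT1_mem h0 h1 h2).2

/-- `φ′(t) = −½t⁻⁷ + ½t⁻⁴ ∈ [−½lo⁻⁷ + ½hi⁻⁴, −½hi⁻⁷ + ½lo⁻⁴]`. [folklore] -/
theorem phiT1_mem {lo hi t : ℝ} (h0 : 0 < lo) (h1 : lo ≤ t) (h2 : t ≤ hi) :
    -(1 / 2) * lo⁻¹ ^ 7 + 1 / 2 * hi⁻¹ ^ 4 ≤ phiT1 t ∧ phiT1 t ≤ -(1 / 2) * hi⁻¹ ^ 7 + 1 / 2 * lo⁻¹ ^ 4 := by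
  unfold phiT1
  have := inv_pow_le_inv_pow_of_le h0 h1 4; have := inv_pow_le_inv_pow_of_le h0 h1 7
  have := inv_pow_le_inv_pow_of_le (h0.trans_le h1) h2 4; have := inv_pow_le_inv_pow_of_le (h0.trans_le h1) h2 7
  constructor <;> linarith

/-- `φ″(t) = (7/2)t⁻⁸ − 2t⁻⁵ ∈ [(7/2)hi⁻⁸ − 2lo⁻⁵, (7/2)lo⁻⁸ − 2hi⁻⁵]`. [folklore] -/
theorem phiT2_mem {lo hi t : ℝ} (h0 : 0 < lo) (h1 : lo ≤ t) (h2 : t ≤ hi) :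
    7 / 2 * hi⁻¹ ^ 8 - 2 * lo⁻¹ ^ 5 ≤ phiT2 t ∧ phiT2 t ≤ 7 / 2 * lo⁻¹ ^ 8 - 2 * hi⁻¹ ^ 5 := by
  unfold phiT2
  have := inv_pow_le_inv_pow_of_le h0 h1 5; have := inv_pow_le_inv_pow_of_le h0 h1 8
  have := inv_pow_le_inv_pow_of_le (h0.trans_le h1) h2 5; have := inv_pow_le_inv_pow_of_le (h0.trans_le h1) h2 8
  constructor <;> linarith

/-- ★ UPPER enclosure of the clipped negative curvature `secondNeg r = max 0 (−(φ′(r²) − 2r²·max 0 (−φ″(r²))))` on an `r²`-window: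
with `P1lo ≤ φ′`, `P2lo ≤ φ″` the window's lower endpoints, `secondNeg r ≤ max 0 (−P1lo + 2·hi·max 0 (−P2lo))`. [folklore] -/
theorem secondNeg_le {lo hi r : ℝ} (h0 : 0 < lo) (h1 : lo ≤ r ^ 2) (h2 : r ^ 2 ≤ hi) :
    secondNeg r ≤ max 0 (-(-(1 / 2) * lo⁻¹ ^ 7 + 1 / 2 * hi⁻¹ ^ 4) + 2 * hi * max 0 (-(7 / 2 * hi⁻¹ ^ 8 - 2 * lo⁻¹ ^ 5))) := by
  unfold secondNeg
  have hP1 := (phiT1_mem h0 h1 h2).1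
  have hP2 := (phiT2_mem h0 h1 h2).1
  have hM : max 0 (-phiT2 (r ^ 2)) ≤ max 0 (-(7 / 2 * hi⁻¹ ^ 8 - 2 * lo⁻¹ ^ 5)) := max_le_max le_rfl (by linarith)
  have hM0 : 0 ≤ max 0 (-phiT2 (r ^ 2)) := le_max_left _ _
  have hhi : 0 ≤ hi := le_trans (sq_nonneg r) h2
  refine max_le_max le_rfl ?_
  nlinarith [mul_le_mul h2 hM hM0 hhi]

/-! ## §3. The booked columns -/

/-- ★ UPPER enclosure of the force Taylor column `forceRem r η` ((225)) on an `r`-window `[rlo, rhi]` with `η < rlo` (monotone factors: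
`((r−η)²)⁻¹^k` antitone, `(2rη + η²)`, `(r + η)` monotone, `|ψ′(r²)|` by `abs_psiT1_le` on `[rlo², rhi²]`). [folklore] -/
theorem forceRem_le_window {rlo rhi r η : ℝ} (hη : 0 ≤ η) (hlo : η < rlo) (h1 : rlo ≤ r) (h2 : r ≤ rhi) :
    forceRem r η ≤ max (10 * ((rlo - η) ^ 2)⁻¹ ^ 6) (28 * ((rlo - η) ^ 2)⁻¹ ^ 9) * (2 * rhi * η + η ^ 2) ^ 2 * (rhi + η)
      + max (-(-4 * (rlo ^ 2)⁻¹ ^ 5 + 7 * (rhi ^ 2)⁻¹ ^ 8)) (-4 * (rhi ^ 2)⁻¹ ^ 5 + 7 * (rlo ^ 2)⁻¹ ^ 8)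
        * (η ^ 2 * rhi + (2 * rhi * η + η ^ 2) * η) := by
  unfold forceRem
  have hr : 0 < rlo := hη.trans_lt hlo
  have hρ : 0 < (rlo - η) ^ 2 := by nlinarith
  have hρle : (rlo - η) ^ 2 ≤ (r - η) ^ 2 := by nlinarith
  have hk6 := inv_pow_le_inv_pow_of_le hρ hρle 6
  have hk9 := inv_pow_le_inv_pow_of_le hρ hρle 9
  have hM : max (10 * ((r - η) ^ 2)⁻¹ ^ 6) (28 * ((r - η) ^ 2)⁻¹ ^ 9) ≤ max (10 * ((rlo - η) ^ 2)⁻¹ ^ 6) (28 * ((rlo - η) ^ 2)⁻¹ ^ 9) :=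
    max_le_max (by linarith) (by linarith)
  have hM0 : 0 ≤ max (10 * ((r - η) ^ 2)⁻¹ ^ 6) (28 * ((r - η) ^ 2)⁻¹ ^ 9) :=
    le_max_of_le_left (by positivity)
  have hA : 2 * r * η + η ^ 2 ≤ 2 * rhi * η + η ^ 2 := by nlinarith
  have hA0 : 0 ≤ 2 * r * η + η ^ 2 := by nlinarith
  have hB : r + η ≤ rhi + η := by linarith
  have hB0 : 0 ≤ r + η := by linarith
  have hsq1 : rlo ^ 2 ≤ r ^ 2 := by nlinarith
  have hsq2 : r ^ 2 ≤ rhi ^ 2 := by nlinarith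
  have hΨ := abs_psiT1_le (pow_pos hr 2) hsq1 hsq2
  have hΨ0 : 0 ≤ |psiT1 (r ^ 2)| := abs_nonneg _
  have hC : η ^ 2 * r + (2 * r * η + η ^ 2) * η ≤ η ^ 2 * rhi + (2 * rhi * η + η ^ 2) * η := by nlinarith
  have hC0 : 0 ≤ η ^ 2 * r + (2 * r * η + η ^ 2) * η := by
    have : 0 ≤ r := hr.le.trans h1
    positivity
  have hsqA : (2 * r * η + η ^ 2) ^ 2 ≤ (2 * rhi * η + η ^ 2) ^ 2 := pow_le_pow_left₀ hA0 hA 2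
  have hP : 0 ≤ max (10 * ((rlo - η) ^ 2)⁻¹ ^ 6) (28 * ((rlo - η) ^ 2)⁻¹ ^ 9) * (2 * rhi * η + η ^ 2) ^ 2 :=
    mul_nonneg (hM0.trans hM) (sq_nonneg _)
  exact add_le_add (mul_le_mul (mul_le_mul hM hsqA (sq_nonneg _) (hM0.trans hM)) hB hB0 hP)
    (mul_le_mul hΨ hC hC0 (hΨ0.trans hΨ))

/-- ★ UPPER enclosure of the energy Taylor column `energyRem r η` ((225)) on an `r`-window, same pattern (`|φ″(r²)|` by `phiT2_mem`). [folklore] -/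
theorem energyRem_le_window {rlo rhi r η : ℝ} (hη : 0 ≤ η) (hlo : η < rlo) (h1 : rlo ≤ r) (h2 : r ≤ rhi) :
    energyRem r η ≤ max (14 / 3 * ((rlo - η) ^ 2)⁻¹ ^ 9) (5 / 3 * ((rlo - η) ^ 2)⁻¹ ^ 6) * (2 * rhi * η + η ^ 2) ^ 3
      + max (-(7 / 2 * (rhi ^ 2)⁻¹ ^ 8 - 2 * (rlo ^ 2)⁻¹ ^ 5)) (7 / 2 * (rlo ^ 2)⁻¹ ^ 8 - 2 * (rhi ^ 2)⁻¹ ^ 5) * (2 * rhi * η ^ 3 + 1 / 2 * η ^ 4) := by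
  unfold energyRem
  have hr : 0 < rlo := hη.trans_lt hlo
  have hρ : 0 < (rlo - η) ^ 2 := by nlinarith
  have hρle : (rlo - η) ^ 2 ≤ (r - η) ^ 2 := by nlinarith
  have hk6 := inv_pow_le_inv_pow_of_le hρ hρle 6
  have hk9 := inv_pow_le_inv_pow_of_le hρ hρle 9
  have hM : max (14 / 3 * ((r - η) ^ 2)⁻¹ ^ 9) (5 / 3 * ((r - η) ^ 2)⁻¹ ^ 6) ≤
      max (14 / 3 * ((rlo - η) ^ 2)⁻¹ ^ 9) (5 / 3 * ((rlo - η) ^ 2)⁻¹ ^ 6) := max_le_max (by linarith) (by linarith)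
  have hM0 : 0 ≤ max (14 / 3 * ((r - η) ^ 2)⁻¹ ^ 9) (5 / 3 * ((r - η) ^ 2)⁻¹ ^ 6) := le_max_of_le_left (by positivity)
  have hA : 2 * r * η + η ^ 2 ≤ 2 * rhi * η + η ^ 2 := by nlinarith
  have hA0 : 0 ≤ 2 * r * η + η ^ 2 := by nlinarith
  have hsq1 : rlo ^ 2 ≤ r ^ 2 := by nlinarith
  have hsq2 : r ^ 2 ≤ rhi ^ 2 := by nlinarith
  have hΦ := abs_le_max_neg (phiT2_mem (pow_pos hr 2) hsq1 hsq2).1 (phiT2_mem (pow_pos hr 2) hsq1 hsq2).2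
  have hΦ0 : 0 ≤ |phiT2 (r ^ 2)| := abs_nonneg _
  have hC : 2 * r * η ^ 3 + 1 / 2 * η ^ 4 ≤ 2 * rhi * η ^ 3 + 1 / 2 * η ^ 4 := by nlinarith [pow_nonneg hη 3]
  have hC0 : 0 ≤ 2 * r * η ^ 3 + 1 / 2 * η ^ 4 := by
    have : 0 ≤ r := hr.le.trans h1
    positivity
  have hcube : (2 * r * η + η ^ 2) ^ 3 ≤ (2 * rhi * η + η ^ 2) ^ 3 := pow_le_pow_left₀ hA0 hA 3
  exact add_le_add (mul_le_mul hM hcube (pow_nonneg hA0 3) (hM0.trans hM)) (mul_le_mul hΦ hC hC0 (hΦ0.trans hΦ))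

/-- The far force column `farCol` ((226)) is ANTITONE on `(0, ∞)`. [folklore] -/
theorem farCol_anti {R R' : ℝ} (h0 : 0 < R) (h : R ≤ R') : farCol R' ≤ farCol R := by
  unfold farCol
  have := inv_pow_le_inv_pow_of_le h0 h 4; have := inv_pow_le_inv_pow_of_le h0 h 5; have := inv_pow_le_inv_pow_of_le h0 h 6
  have := inv_pow_le_inv_pow_of_le h0 h 7; have := inv_pow_le_inv_pow_of_le h0 h 10; have := inv_pow_le_inv_pow_of_le h0 h 11
  have := inv_pow_le_inv_pow_of_le h0 h 12; have := inv_pow_le_inv_pow_of_le h0 h 13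
  linarith

/-- The far energy column `tailCol` ((226)) is ANTITONE on `(0, ∞)`. [folklore] -/
theorem tailCol_anti {R R' : ℝ} (h0 : 0 < R) (h : R ≤ R') : tailCol R' ≤ tailCol R := by
  unfold tailCol
  have := inv_pow_le_inv_pow_of_le h0 h 3; have := inv_pow_le_inv_pow_of_le h0 h 4
  have := inv_pow_le_inv_pow_of_le h0 h 5; have := inv_pow_le_inv_pow_of_le h0 h 6
  linarith

/-- The form (226) uses: if `‖x‖ ≤ ρ` and the shrunken distance stays positive, `farCol (Rc − (‖x‖ + τ)) ≤ farCol (Rc − (ρ + τ))`. [folklore] -/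
theorem farCol_le_of_norm_le {x : EuclideanSpace ℝ (Fin 3)} {ρ τ Rc : ℝ} (hx : ‖x‖ ≤ ρ) (hpos : 0 < Rc - (ρ + τ)) :
    farCol (Rc - (‖x‖ + τ)) ≤ farCol (Rc - (ρ + τ)) :=
  farCol_anti hpos (by linarith)

/-! ## §4. Vectors in `E3`, sqrt-free -/

/-- ★ NORM BY SQUARES: `0 ≤ b`, `Σ_i w_i² ≤ b² ⇒ ‖w‖ ≤ b` (the K files never take square roots). [folklore] -/
theorem norm_le_of_sq_sum_le {w : EuclideanSpace ℝ (Fin 3)} {b : ℝ} (hb : 0 ≤ b) (h : ∑ i, w i ^ 2 ≤ b ^ 2) : ‖w‖ ≤ b := by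
  have h1 : ‖w‖ ^ 2 ≤ b ^ 2 := by rw [Literature.Analysis.Convexity.norm_sq_eq_sum_sq_coord]; exact h
  nlinarith [norm_nonneg w, mul_nonneg (add_nonneg (norm_nonneg w) hb) hb]

/-- Coordinate boxes ⇒ `Σ_i w_i² ≤ Σ_i max(−lo_i, hi_i)²`. [folklore] -/
theorem sq_sum_le_of_coord_mem {w lo hi : EuclideanSpace ℝ (Fin 3)} (h1 : ∀ i, lo i ≤ w i) (h2 : ∀ i, w i ≤ hi i) :
    ∑ i, w i ^ 2 ≤ ∑ i, max (-lo i) (hi i) ^ 2 := by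
  refine Finset.sum_le_sum fun i _ => ?_
  have h := abs_le_max_neg (h1 i) (h2 i)
  calc w i ^ 2 = |w i| ^ 2 := (sq_abs _).symm
    _ ≤ max (-lo i) (hi i) ^ 2 := pow_le_pow_left₀ (abs_nonneg _) h 2

end Summit.AtomisticToContinuum.Crystallization.Theorems.FrustratedLawDichotomyCellEnclosures

end
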